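import Summits.QuantumFields.YangMills.Theorems.UnitScaleTiltHistoryTailOneSupplierFL
import Summits.QuantumFields.YangMills.Theorems.AlphaInputsT3ACv3InnerLiftFromRegionalWindow
import Summits.QuantumFields.YangMills.Theorems.AlphaInputsT3ACv3RecordFLOneSupplier
import HarnessLib

/-!
# `UnitScaleTiltHistoryTailOneSupplierWindow` — THE ONE-SUPPLIER THEOREMS OF `HistoryTailL` ∕ 2′χ ∕ 2′ WITH THE (FL) ROW IN ITS FINAL CURRENCY: the `hLift` binder CARRYING THE
# SMALLNESS PREMISE `ε_W(k) ≤ ε_FL` (★★OWNER g25 RULING (FL-SMALL) 03:29:46Z: every (FL) knit carries `(hε : ε′ ≤ ε_FL)`; the record discharges it by the row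
# `avgWindowFactor L ≤ 8·B₃·Z_full·ε_FL` and (FL-θ)) — the window twins of ★w5-19936 g0's `…OneSupplierFL` — lane `pub-balaban3d` ∕ cell `ym3-torus`, seat alpha-2 (g6)

WHY.  `…OneSupplierFL` reads (FL) through ★w1 g0's `hLift` binder at any `B_L ≥ 1`, record `B₃ ≥ B_L·L²`.  The regional Newton lift of record (★w4 (H)
`exists_exact_lift_regional_window_kfree` ∘ START v3, kernel `obLift`) delivers that binder only under `ε_W(k) ≤ ε_FL` with `ε_FL` a closed numeral; on the record's coupling window
(FL-θ) gives `ε_W(k) ≤ avgWindowFactor L/(8·B₃·Z_full)` (`…ThetaWindow`), so the premise is ONE arithmetic row of the record.  THIS FILE re-types the three one-supplier theorems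
with the windowed binder and that row (`…InnerLiftFromRegionalWindow.innerFineLiftsT3_of_regionalLifts_window`), for the χ display (19936∕20520) AND the plain display (19935):
the final `hLift` knit (MAP M22) then only has to produce, per record, the windowed binder at some `(B_L, ε_FL)` and choose `B₃ ≥ max(B_L·L², avgWindowFactor L/(8·Z_full·ε_FL))`.
WHAT (def-free).  §1 `innerFineLiftsT3_of_regionalLiftsWindow_le`; §2 (χ) ★★ `pinnedPartsT3ACRecFLChi_of_thm1_regionalLiftsWindow_rows`,
`alphaInputsT3ACv3RecChi_of_thm1_regionalLiftsWindow_rows`, ★★★ `historyTailL_of_thm1In8_regionalLiftsWindow_rows_allL`; §3 (plain, 19935) ★★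
`pinnedPartsT3ACRecFL_of_thm1_regionalLiftsWindow_rows`, `alphaInputsT3ACv3Rec_of_thm1_regionalLiftsWindow_rows`.
HONEST FRAMING.  Bookkeeping∕composition of landed theorems; (T), the windowed `hLift` binder and the data rows stay HYPOTHESES; count-neutral helper toward R3 2′∕2′χ
(`stub_laneRecordsV3`∕`stub_laneRecordsV3Chi`, items 19935∕19936 — NOT closed here); registry untouched.  YM₃ on the three-torus is rung R3 of the programme, not the Clay problem:
nothing here is about d = 4, infinite volume, or a mass gap.

References: T. Bałaban, Commun. Math. Phys. 102 (1985) 277–309 [Balaban1985Variational] (Thm 1 (6)–(8) pp.278–279, (11)–(14) pp.279–280); Commun. Math. Phys. 102 (1985)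
255–275 [Balaban1985UV3] ((5) p.256, (7) p.257, (40)–(42) p.266, (45)+(47) p.267, (68)+(71) p.273, Thm 2 p.272); C. King, Commun. Math. Phys. 102 (1986) 649–677 [King1986]
((3.12) p.657).
-/

set_option autoImplicit false

noncomputable section

namespace Summit.QuantumFields.YangMills.Theorems.HistoryTailOneSupplier

open MeasureTheory Set
open scoped Matrix.Norms.L2Operator
open Literature.MathematicalPhysics.QuantumFieldTheory.Balaban1983to89
open Literature.MathematicalPhysics.QuantumFieldTheory.Balaban1983to89.T3ContinuumYM3Torus
open Literature.MathematicalPhysics.QuantumFieldTheory.Balaban1983to89.T3UnitLawDensityEML (ℰp)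
open Literature.MathematicalPhysics.QuantumFieldTheory.Balaban1983to89.T3UnitScaleTilt (θBal)
open Literature.MathematicalPhysics.QuantumFieldTheory.Balaban1983to89.T3MinimiserStabilityReduction (θBal_pos)
open Literature.MathematicalPhysics.QuantumFieldTheory.Balaban1983to89.T3PrintedMinimiserExistence (Thm1GlobalMinAt)
open Literature.MathematicalPhysics.QuantumFieldTheory.Balaban1983to89.T3LowerAlongMinimisersSplit (MinimisersIn8At)
open Literature.MathematicalPhysics.QuantumFieldTheory.Balaban1983to89.ExpMeanLog (deltaSU deltaSU_pos)
open Literature.MathematicalPhysics.QuantumFieldTheory.Balaban1983to89.B10Eq38TorusDomains (plaqsIn)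
open Literature.MathematicalPhysics.QuantumFieldTheory.Balaban1983to89.B10Eq42TorusConstraint (bondsIn)
open Literature.MathematicalPhysics.QuantumFieldTheory.Balaban1985CMP102.Setting
open Summit.QuantumFields.Balaban3D.Carriers
open Summit.QuantumFields.Balaban3D.Proofs.Primitives
open Summit.QuantumFields.Balaban3D.Proofs.Thresholds (Q0 Q0_pos)
open Summit.QuantumFields.YangMills.Theorems.RecordFLOneSupplier (pinnedPartsT3ACRecFL_of_thm1_rows)
open B7Prop2Explicit (C0 C0_pos)

/-! ## §1 (FL) at the record's `B₃` from the WINDOWED `hLift` at any `B_L ≥ 1` with `B_L·L² ≤ B₃` and the record row -/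

/-- **(FL) AT THE RECORD'S CONSTANT FROM THE WINDOWED `hLift` BINDER** (`1 ≤ B_L`, `B_L·L² ≤ B₃`, record row `avgWindowFactor L ≤ 8·B₃·Z_full·ε_FL`):
`innerFineLiftsT3_of_regionalLifts_window` then `innerFineLiftsT3_mono`. [cite: Balaban1985Variational, Thm 1 (8) p.279, (11)–(14) pp.279–280; Balaban1985UV3, (7) p.257, (40)+(42) p.266, (45) p.267] -/
theorem innerFineLiftsT3_of_regionalLiftsWindow_le {F : T3Family} {𝔠 : AlphaConsts F.L (suGroupModel 2).N} {γ : ℝ} {hγ : 0 < γ}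
    {hγ1 : γ ≤ (min 𝔠.gamma0 1) ^ 2} {K : ℕ} {B εFL : ℝ} (hB : 1 ≤ B) (hBB : B * (F.L : ℝ) ^ 2 ≤ 𝔠.B₃)
    (hrow : avgWindowFactor F.L ≤ 8 * 𝔠.B₃ * 𝔠.Zfull * εFL)
    (hLift : ∀ (k : ℕ), k + 1 ≤ K → ∀ (h : Hist (F.P K) (k + 1)),
      Hist.Admissible 𝔠.lane.carrier.M₁ (rcolOf (T3Scales F γ hγ (hγ1.trans (sq_min_one_le _ 𝔠.gamma0_pos)) K) 𝔠.lane.carrier) (k + 1) h →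
      h ≠ Hist.triv (F.P K) (k + 1) → ∀ (V : GaugeField (F.P K) k (Matrix.specialUnitaryGroup (Fin 2) ℂ)),
        (∀ Q : Plaq (F.P K) k, Q ∈ plaqsIn k (Omega 𝔠.lane.carrier.M₁
            (rcolOf (T3Scales F γ hγ (hγ1.trans (sq_min_one_le _ 𝔠.gamma0_pos)) K) 𝔠.lane.carrier) (k + 1) h (k + 1)) →
          GaugeGroup.dist1 (GaugeField.plaqHol V Q) ≤ 2 * (F.L : ℝ) ^ 2 * avgWindowFactor F.L * θBal F.L γ 𝔠.b₀ 𝔠.p₀ (K - k)) →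
        2 * (F.L : ℝ) ^ 2 * avgWindowFactor F.L * θBal F.L γ 𝔠.b₀ 𝔠.p₀ (K - k) ≤ εFL →
        ∃ U : GaugeField (F.P K) 0 (Matrix.specialUnitaryGroup (Fin 2) ℂ),
          (∀ b : PBond (F.P K) k, b ∈ bondsIn k (Omega 𝔠.lane.carrier.M₁
              (rcolOf (T3Scales F γ hγ (hγ1.trans (sq_min_one_le _ 𝔠.gamma0_pos)) K) 𝔠.lane.carrier) (k + 1) h (k + 1)) →
            Averaging.iter (fun i => BlockAveraging.blockAvg (P := F.P K) (j := i) ℰp) k U b = V b) ∧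
          ∀ q : Plaq (F.P K) 0, q ∈ plaqsIn 0 (Omega 𝔠.lane.carrier.M₁
              (rcolOf (T3Scales F γ hγ (hγ1.trans (sq_min_one_le _ 𝔠.gamma0_pos)) K) 𝔠.lane.carrier) (k + 1) h (k + 1)) →
            GaugeGroup.dist1 (GaugeField.plaqHol U q) <
              B * (2 * (F.L : ℝ) ^ 2 * avgWindowFactor F.L * θBal F.L γ 𝔠.b₀ 𝔠.p₀ (K - k)) * (((F.L : ℝ) ^ k)⁻¹) ^ 2) :
    AlphaInputsT3AC.InnerFineLiftsT3 F 𝔠 γ hγ hγ1 K 𝔠.B₃ :=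
  innerFineLiftsT3_mono (AlphaInputsT3AC.innerFineLiftsT3_of_regionalLifts_window F 𝔠 γ hγ hγ1 K hB hrow hLift) hBB

/-! ## §2 The χ display, the 2′χ text and the crux with the windowed (FL) row -/

/-- ★★ **THE 2′χ DISPLAY OF RECORD FROM (T) AT ANY CONSTANTS AND THE SUPPLIER ROWS, (FL) AS THE WINDOWED `hLift`** — `pinnedPartsT3ACRecFLChi_of_thm1_rows` with the per-family
(FL) conjunct supplied by §1 from «`∃ B_L ε_FL`, `1 ≤ B_L`, `B_L·L² ≤ B₃`, `avgWindowFactor L ≤ 8·B₃·Z_full·ε_FL`, windowed `hLift` at `(B_L, ε_FL)` for every coupling and run».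
[cite: Balaban1985Variational, Thm 1 (6)–(8) pp.278–279, (11)–(14) pp.279–280; Balaban1985UV3, (7) p.257, (40)–(42) p.266, (45)+(47) p.267, (68) p.273 and Thm 2 p.272] -/
theorem pinnedPartsT3ACRecFLChi_of_thm1_regionalLiftsWindow_rows {L : ℕ} (hL : 1 < L)
    (hT : ∃ a₀ a₁ B₃ : ℝ, 0 < a₀ ∧ 0 < a₁ ∧ 0 < B₃ ∧ Thm1GlobalMinAt L a₀ a₁ B₃)
    {B₀ A₀ A₁ : ℝ} (hA₀ : 0 < A₀) (hA₁ : 0 < A₁)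
    (hrows : ∀ (B a₀ a₁ : ℝ), B₀ ≤ B → 1 ≤ 2 * B → 0 < a₀ → a₀ ≤ A₀ → 0 < a₁ → a₁ ≤ A₁ → B * a₁ ≤ a₀ →
        (143 * ((((3 + 4 : ℕ) : ℝ)) ^ 2 / 4) ^ 2) * (2 * (B * a₁)) ≤ 1 / 3 →
        2 * (2 * (B * a₁)) ≤ 2 * deltaSU (Fin 2) / (((3 + 4) * L : ℕ) : ℝ) ^ 2 →
        Thm1GlobalMinAt L a₀ a₁ B →
        ∃ (b₁ p₁ : ℝ), ∀ (b₀ p₀ : ℝ), b₁ ≤ b₀ → p₁ ≤ p₀ →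
          ∃ 𝔠 : AlphaConsts L (suGroupModel 2).N, 𝔠.b₀ = b₀ ∧ 𝔠.p₀ = p₀ ∧ 𝔠.B₃ = B ∧
            4 * 𝔠.B₃ * (L : ℝ) ^ 2 * avgWindowFactor L ≤ 𝔠.C68 ∧
            Real.exp (𝔠.p₀ - 1) ≤ 3 * C0 3 * 𝔠.C68 * (𝔠.b₀ * Q0 𝔠.p₀) ∧
            (𝔠.b₀ * Q0 𝔠.p₀) * (2 * (L : ℝ) ^ 2 * avgWindowFactor L) ^ 2 ≤ 3 * C0 3 * 𝔠.C68 * a₁ ^ 2 ∧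
            7 * L + 3 ≤ 𝔠.M₁ ∧
            ∀ (F : T3Family) (hF : F.L = L),
              (∃ B_L εFL : ℝ, 1 ≤ B_L ∧ B_L * (F.L : ℝ) ^ 2 ≤ (hF ▸ 𝔠).B₃ ∧ avgWindowFactor F.L ≤ 8 * (hF ▸ 𝔠).B₃ * (hF ▸ 𝔠).Zfull * εFL ∧
                ∀ (γ : ℝ) (hγ : 0 < γ) (hγ1 : γ ≤ (min (hF ▸ 𝔠).gamma0 1) ^ 2) (K : ℕ),
                ∀ (k : ℕ), k + 1 ≤ K → ∀ (h : Hist (F.P K) (k + 1)),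
                  Hist.Admissible (hF ▸ 𝔠).lane.carrier.M₁ (rcolOf (T3Scales F γ hγ (hγ1.trans (sq_min_one_le _ (hF ▸ 𝔠).gamma0_pos)) K) (hF ▸ 𝔠).lane.carrier) (k + 1) h →
                  h ≠ Hist.triv (F.P K) (k + 1) → ∀ (V : GaugeField (F.P K) k (Matrix.specialUnitaryGroup (Fin 2) ℂ)),
                    (∀ Q : Plaq (F.P K) k, Q ∈ plaqsIn k (Omega (hF ▸ 𝔠).lane.carrier.M₁
                        (rcolOf (T3Scales F γ hγ (hγ1.trans (sq_min_one_le _ (hF ▸ 𝔠).gamma0_pos)) K) (hF ▸ 𝔠).lane.carrier) (k + 1) h (k + 1)) →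
                      GaugeGroup.dist1 (GaugeField.plaqHol V Q) ≤ 2 * (F.L : ℝ) ^ 2 * avgWindowFactor F.L * θBal F.L γ (hF ▸ 𝔠).b₀ (hF ▸ 𝔠).p₀ (K - k)) →
                    2 * (F.L : ℝ) ^ 2 * avgWindowFactor F.L * θBal F.L γ (hF ▸ 𝔠).b₀ (hF ▸ 𝔠).p₀ (K - k) ≤ εFL →
                    ∃ U : GaugeField (F.P K) 0 (Matrix.specialUnitaryGroup (Fin 2) ℂ),
                      (∀ b : PBond (F.P K) k, b ∈ bondsIn k (Omega (hF ▸ 𝔠).lane.carrier.M₁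
                          (rcolOf (T3Scales F γ hγ (hγ1.trans (sq_min_one_le _ (hF ▸ 𝔠).gamma0_pos)) K) (hF ▸ 𝔠).lane.carrier) (k + 1) h (k + 1)) →
                        Averaging.iter (fun i => BlockAveraging.blockAvg (P := F.P K) (j := i) ℰp) k U b = V b) ∧
                      ∀ q : Plaq (F.P K) 0, q ∈ plaqsIn 0 (Omega (hF ▸ 𝔠).lane.carrier.M₁
                          (rcolOf (T3Scales F γ hγ (hγ1.trans (sq_min_one_le _ (hF ▸ 𝔠).gamma0_pos)) K) (hF ▸ 𝔠).lane.carrier) (k + 1) h (k + 1)) →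
                        GaugeGroup.dist1 (GaugeField.plaqHol U q) <
                          B_L * (2 * (F.L : ℝ) ^ 2 * avgWindowFactor F.L * θBal F.L γ (hF ▸ 𝔠).b₀ (hF ▸ 𝔠).p₀ (K - k)) * (((F.L : ℝ) ^ k)⁻¹) ^ 2) ∧
              (∀ (γ : ℝ) (hγ : 0 < γ) (hγ1 : γ ≤ (min (hF ▸ 𝔠).gamma0 1) ^ 2) (K : ℕ),
                (∃ Ut : (k : ℕ) → GaugeField (F.P K) k (Matrix.specialUnitaryGroup (Fin 2) ℂ) →
                    GaugeField (F.P K) 0 (Matrix.specialUnitaryGroup (Fin 2) ℂ),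
                  AlphaInputsT3AC.TrivMinimiserRowsT3 F (hF ▸ 𝔠) γ hγ hγ1 a₀ a₁ K Ut) →
                ∃ Ut : (k : ℕ) → GaugeField (F.P K) k (Matrix.specialUnitaryGroup (Fin 2) ℂ) →
                    GaugeField (F.P K) 0 (Matrix.specialUnitaryGroup (Fin 2) ℂ),
                  AlphaInputsT3AC.TrivMinimiserRowsT3 F (hF ▸ 𝔠) γ hγ hγ1 a₀ a₁ K Ut ∧
                    AlphaInputsT3AC.DataRowsT3XChi F (hF ▸ 𝔠) γ hγ hγ1 K Ut)) :
    AlphaInputsT3AC.PinnedPartsT3ACRecFLChi L := by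
  refine pinnedPartsT3ACRecFLChi_of_thm1_rows hL hT hA₀ hA₁ (B₀ := B₀) fun B a₀ a₁ h1 h2 h3 h4 h5 h6 h7 h8 h9 h10 => ?_
  obtain ⟨b₁, p₁, hrec⟩ := hrows B a₀ a₁ h1 h2 h3 h4 h5 h6 h7 h8 h9 h10
  refine ⟨b₁, p₁, fun b₀ p₀ hb hp => ?_⟩
  obtain ⟨𝔠, e1, e2, e3, s1, s2, s3, s4, hFO⟩ := hrec b₀ p₀ hb hp
  refine ⟨𝔠, e1, e2, e3, s1, s2, s3, s4, fun F hF => ⟨fun γ hγ hγ1 K => ?_, (hFO F hF).2⟩⟩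
  obtain ⟨B_L, εFL, hBL, hBB, hrow, hLift⟩ := (hFO F hF).1
  exact innerFineLiftsT3_of_regionalLiftsWindow_le hBL hBB hrow (hLift γ hγ hγ1 K)

/-- ★★ **THE REGISTERED 2′χ TEXT FROM (T) AT ANY CONSTANTS AND THE SUPPLIER ROWS, (FL) AS THE WINDOWED `hLift`** (serves 20520's v5kC 2′χ identically).
[cite: Balaban1985UV3, Thm 2 p.272 and (47) p.267; Balaban1985Variational, Thm 1 (8) p.279] -/
theorem alphaInputsT3ACv3RecChi_of_thm1_regionalLiftsWindow_rows {L : ℕ} (hL : 1 < L)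
    (hT : ∃ a₀ a₁ B₃ : ℝ, 0 < a₀ ∧ 0 < a₁ ∧ 0 < B₃ ∧ Thm1GlobalMinAt L a₀ a₁ B₃)
    {B₀ A₀ A₁ : ℝ} (hA₀ : 0 < A₀) (hA₁ : 0 < A₁)
    (hrows : ∀ (B a₀ a₁ : ℝ), B₀ ≤ B → 1 ≤ 2 * B → 0 < a₀ → a₀ ≤ A₀ → 0 < a₁ → a₁ ≤ A₁ → B * a₁ ≤ a₀ →
        (143 * ((((3 + 4 : ℕ) : ℝ)) ^ 2 / 4) ^ 2) * (2 * (B * a₁)) ≤ 1 / 3 →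
        2 * (2 * (B * a₁)) ≤ 2 * deltaSU (Fin 2) / (((3 + 4) * L : ℕ) : ℝ) ^ 2 →
        Thm1GlobalMinAt L a₀ a₁ B →
        ∃ (b₁ p₁ : ℝ), ∀ (b₀ p₀ : ℝ), b₁ ≤ b₀ → p₁ ≤ p₀ →
          ∃ 𝔠 : AlphaConsts L (suGroupModel 2).N, 𝔠.b₀ = b₀ ∧ 𝔠.p₀ = p₀ ∧ 𝔠.B₃ = B ∧
            4 * 𝔠.B₃ * (L : ℝ) ^ 2 * avgWindowFactor L ≤ 𝔠.C68 ∧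
            Real.exp (𝔠.p₀ - 1) ≤ 3 * C0 3 * 𝔠.C68 * (𝔠.b₀ * Q0 𝔠.p₀) ∧
            (𝔠.b₀ * Q0 𝔠.p₀) * (2 * (L : ℝ) ^ 2 * avgWindowFactor L) ^ 2 ≤ 3 * C0 3 * 𝔠.C68 * a₁ ^ 2 ∧
            7 * L + 3 ≤ 𝔠.M₁ ∧
            ∀ (F : T3Family) (hF : F.L = L),
              (∃ B_L εFL : ℝ, 1 ≤ B_L ∧ B_L * (F.L : ℝ) ^ 2 ≤ (hF ▸ 𝔠).B₃ ∧ avgWindowFactor F.L ≤ 8 * (hF ▸ 𝔠).B₃ * (hF ▸ 𝔠).Zfull * εFL ∧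
                ∀ (γ : ℝ) (hγ : 0 < γ) (hγ1 : γ ≤ (min (hF ▸ 𝔠).gamma0 1) ^ 2) (K : ℕ),
                ∀ (k : ℕ), k + 1 ≤ K → ∀ (h : Hist (F.P K) (k + 1)),
                  Hist.Admissible (hF ▸ 𝔠).lane.carrier.M₁ (rcolOf (T3Scales F γ hγ (hγ1.trans (sq_min_one_le _ (hF ▸ 𝔠).gamma0_pos)) K) (hF ▸ 𝔠).lane.carrier) (k + 1) h →
                  h ≠ Hist.triv (F.P K) (k + 1) → ∀ (V : GaugeField (F.P K) k (Matrix.specialUnitaryGroup (Fin 2) ℂ)),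
                    (∀ Q : Plaq (F.P K) k, Q ∈ plaqsIn k (Omega (hF ▸ 𝔠).lane.carrier.M₁
                        (rcolOf (T3Scales F γ hγ (hγ1.trans (sq_min_one_le _ (hF ▸ 𝔠).gamma0_pos)) K) (hF ▸ 𝔠).lane.carrier) (k + 1) h (k + 1)) →
                      GaugeGroup.dist1 (GaugeField.plaqHol V Q) ≤ 2 * (F.L : ℝ) ^ 2 * avgWindowFactor F.L * θBal F.L γ (hF ▸ 𝔠).b₀ (hF ▸ 𝔠).p₀ (K - k)) →
                    2 * (F.L : ℝ) ^ 2 * avgWindowFactor F.L * θBal F.L γ (hF ▸ 𝔠).b₀ (hF ▸ 𝔠).p₀ (K - k) ≤ εFL →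
                    ∃ U : GaugeField (F.P K) 0 (Matrix.specialUnitaryGroup (Fin 2) ℂ),
                      (∀ b : PBond (F.P K) k, b ∈ bondsIn k (Omega (hF ▸ 𝔠).lane.carrier.M₁
                          (rcolOf (T3Scales F γ hγ (hγ1.trans (sq_min_one_le _ (hF ▸ 𝔠).gamma0_pos)) K) (hF ▸ 𝔠).lane.carrier) (k + 1) h (k + 1)) →
                        Averaging.iter (fun i => BlockAveraging.blockAvg (P := F.P K) (j := i) ℰp) k U b = V b) ∧
                      ∀ q : Plaq (F.P K) 0, q ∈ plaqsIn 0 (Omega (hF ▸ 𝔠).lane.carrier.M₁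
                          (rcolOf (T3Scales F γ hγ (hγ1.trans (sq_min_one_le _ (hF ▸ 𝔠).gamma0_pos)) K) (hF ▸ 𝔠).lane.carrier) (k + 1) h (k + 1)) →
                        GaugeGroup.dist1 (GaugeField.plaqHol U q) <
                          B_L * (2 * (F.L : ℝ) ^ 2 * avgWindowFactor F.L * θBal F.L γ (hF ▸ 𝔠).b₀ (hF ▸ 𝔠).p₀ (K - k)) * (((F.L : ℝ) ^ k)⁻¹) ^ 2) ∧
              (∀ (γ : ℝ) (hγ : 0 < γ) (hγ1 : γ ≤ (min (hF ▸ 𝔠).gamma0 1) ^ 2) (K : ℕ),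
                (∃ Ut : (k : ℕ) → GaugeField (F.P K) k (Matrix.specialUnitaryGroup (Fin 2) ℂ) →
                    GaugeField (F.P K) 0 (Matrix.specialUnitaryGroup (Fin 2) ℂ),
                  AlphaInputsT3AC.TrivMinimiserRowsT3 F (hF ▸ 𝔠) γ hγ hγ1 a₀ a₁ K Ut) →
                ∃ Ut : (k : ℕ) → GaugeField (F.P K) k (Matrix.specialUnitaryGroup (Fin 2) ℂ) →
                    GaugeField (F.P K) 0 (Matrix.specialUnitaryGroup (Fin 2) ℂ),
                  AlphaInputsT3AC.TrivMinimiserRowsT3 F (hF ▸ 𝔠) γ hγ hγ1 a₀ a₁ K Ut ∧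
                    AlphaInputsT3AC.DataRowsT3XChi F (hF ▸ 𝔠) γ hγ hγ1 K Ut)) :
    AlphaInputsT3ACv3RecChi L :=
  alphaInputsT3ACv3RecChi_of_pinnedPartsRecFLChi (pinnedPartsT3ACRecFLChi_of_thm1_regionalLiftsWindow_rows hL hT hA₀ hA₁ hrows)

/-- ★★★ **`HistoryTailL` ⇐ ⟨v5kC's `stub_thm1In8GlobalMin` TEXT⟩ ∧ (∀ odd `L > 1`, THE SUPPLIER ROWS WITH THE WINDOWED (FL) ROW)** — stmt-QuantumFields-19936 BY NAME from
19200's T8 text and, at every odd block size, a floor∕box on which every `(B, a₀, a₁)` is served beyond profile thresholds by a record with exact profile, `B₃ = B`, the free size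
rows, the windowed `hLift` at some `(B_L, ε_FL)` with `B_L·L² ≤ B` and `avgWindowFactor L ≤ 8·B·Z_full·ε_FL`, and the (O″χ) χ data rows.  MAP M22 by name: (T) ⇐ 19200; (FL) ⇐ START
v3 ∘ (H) regional Newton lift (kernel `obLift`); (O″χ) ⇐ NODE O; the window row at the record's construction.
[cite: Balaban1985UV3, (5) p.256, (47) p.267, (71) p.273 and Thm 2 p.272; Balaban1985Variational, Thm 1 (8) p.279, (11)–(14) pp.279–280 and Prop 8 p.304; King1986, (3.12) p.657] -/
theorem historyTailL_of_thm1In8_regionalLiftsWindow_rows_allL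
    (hT8 : ∀ L : ℕ, Odd L → 1 < L → ∃ a₀ a₁ B₃ : ℝ, 0 < a₀ ∧ 0 < a₁ ∧ 0 < B₃ ∧
      Thm1GlobalMinAt L a₀ a₁ B₃ ∧ MinimisersIn8At L a₀ a₁ B₃)
    (hrows : ∀ L : ℕ, Odd L → 1 < L → ∃ (B₀ A₀ A₁ : ℝ), 0 < A₀ ∧ 0 < A₁ ∧
      ∀ (B a₀ a₁ : ℝ), B₀ ≤ B → 1 ≤ 2 * B → 0 < a₀ → a₀ ≤ A₀ → 0 < a₁ → a₁ ≤ A₁ → B * a₁ ≤ a₀ →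
        (143 * ((((3 + 4 : ℕ) : ℝ)) ^ 2 / 4) ^ 2) * (2 * (B * a₁)) ≤ 1 / 3 →
        2 * (2 * (B * a₁)) ≤ 2 * deltaSU (Fin 2) / (((3 + 4) * L : ℕ) : ℝ) ^ 2 →
        Thm1GlobalMinAt L a₀ a₁ B →
        ∃ (b₁ p₁ : ℝ), ∀ (b₀ p₀ : ℝ), b₁ ≤ b₀ → p₁ ≤ p₀ →
          ∃ 𝔠 : AlphaConsts L (suGroupModel 2).N, 𝔠.b₀ = b₀ ∧ 𝔠.p₀ = p₀ ∧ 𝔠.B₃ = B ∧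
            4 * 𝔠.B₃ * (L : ℝ) ^ 2 * avgWindowFactor L ≤ 𝔠.C68 ∧
            Real.exp (𝔠.p₀ - 1) ≤ 3 * C0 3 * 𝔠.C68 * (𝔠.b₀ * Q0 𝔠.p₀) ∧
            (𝔠.b₀ * Q0 𝔠.p₀) * (2 * (L : ℝ) ^ 2 * avgWindowFactor L) ^ 2 ≤ 3 * C0 3 * 𝔠.C68 * a₁ ^ 2 ∧
            7 * L + 3 ≤ 𝔠.M₁ ∧
            ∀ (F : T3Family) (hF : F.L = L),
              (∃ B_L εFL : ℝ, 1 ≤ B_L ∧ B_L * (F.L : ℝ) ^ 2 ≤ (hF ▸ 𝔠).B₃ ∧ avgWindowFactor F.L ≤ 8 * (hF ▸ 𝔠).B₃ * (hF ▸ 𝔠).Zfull * εFL ∧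
                ∀ (γ : ℝ) (hγ : 0 < γ) (hγ1 : γ ≤ (min (hF ▸ 𝔠).gamma0 1) ^ 2) (K : ℕ),
                ∀ (k : ℕ), k + 1 ≤ K → ∀ (h : Hist (F.P K) (k + 1)),
                  Hist.Admissible (hF ▸ 𝔠).lane.carrier.M₁ (rcolOf (T3Scales F γ hγ (hγ1.trans (sq_min_one_le _ (hF ▸ 𝔠).gamma0_pos)) K) (hF ▸ 𝔠).lane.carrier) (k + 1) h →
                  h ≠ Hist.triv (F.P K) (k + 1) → ∀ (V : GaugeField (F.P K) k (Matrix.specialUnitaryGroup (Fin 2) ℂ)),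
                    (∀ Q : Plaq (F.P K) k, Q ∈ plaqsIn k (Omega (hF ▸ 𝔠).lane.carrier.M₁
                        (rcolOf (T3Scales F γ hγ (hγ1.trans (sq_min_one_le _ (hF ▸ 𝔠).gamma0_pos)) K) (hF ▸ 𝔠).lane.carrier) (k + 1) h (k + 1)) →
                      GaugeGroup.dist1 (GaugeField.plaqHol V Q) ≤ 2 * (F.L : ℝ) ^ 2 * avgWindowFactor F.L * θBal F.L γ (hF ▸ 𝔠).b₀ (hF ▸ 𝔠).p₀ (K - k)) →
                    2 * (F.L : ℝ) ^ 2 * avgWindowFactor F.L * θBal F.L γ (hF ▸ 𝔠).b₀ (hF ▸ 𝔠).p₀ (K - k) ≤ εFL →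
                    ∃ U : GaugeField (F.P K) 0 (Matrix.specialUnitaryGroup (Fin 2) ℂ),
                      (∀ b : PBond (F.P K) k, b ∈ bondsIn k (Omega (hF ▸ 𝔠).lane.carrier.M₁
                          (rcolOf (T3Scales F γ hγ (hγ1.trans (sq_min_one_le _ (hF ▸ 𝔠).gamma0_pos)) K) (hF ▸ 𝔠).lane.carrier) (k + 1) h (k + 1)) →
                        Averaging.iter (fun i => BlockAveraging.blockAvg (P := F.P K) (j := i) ℰp) k U b = V b) ∧
                      ∀ q : Plaq (F.P K) 0, q ∈ plaqsIn 0 (Omega (hF ▸ 𝔠).lane.carrier.M₁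
                          (rcolOf (T3Scales F γ hγ (hγ1.trans (sq_min_one_le _ (hF ▸ 𝔠).gamma0_pos)) K) (hF ▸ 𝔠).lane.carrier) (k + 1) h (k + 1)) →
                        GaugeGroup.dist1 (GaugeField.plaqHol U q) <
                          B_L * (2 * (F.L : ℝ) ^ 2 * avgWindowFactor F.L * θBal F.L γ (hF ▸ 𝔠).b₀ (hF ▸ 𝔠).p₀ (K - k)) * (((F.L : ℝ) ^ k)⁻¹) ^ 2) ∧
              (∀ (γ : ℝ) (hγ : 0 < γ) (hγ1 : γ ≤ (min (hF ▸ 𝔠).gamma0 1) ^ 2) (K : ℕ),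
                (∃ Ut : (k : ℕ) → GaugeField (F.P K) k (Matrix.specialUnitaryGroup (Fin 2) ℂ) →
                    GaugeField (F.P K) 0 (Matrix.specialUnitaryGroup (Fin 2) ℂ),
                  AlphaInputsT3AC.TrivMinimiserRowsT3 F (hF ▸ 𝔠) γ hγ hγ1 a₀ a₁ K Ut) →
                ∃ Ut : (k : ℕ) → GaugeField (F.P K) k (Matrix.specialUnitaryGroup (Fin 2) ℂ) →
                    GaugeField (F.P K) 0 (Matrix.specialUnitaryGroup (Fin 2) ℂ),
                  AlphaInputsT3AC.TrivMinimiserRowsT3 F (hF ▸ 𝔠) γ hγ hγ1 a₀ a₁ K Ut ∧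
                    AlphaInputsT3AC.DataRowsT3XChi F (hF ▸ 𝔠) γ hγ hγ1 K Ut)) :
    Summit.QuantumFields.YangMills.Theses.UnitScaleTilt.HistoryTailL := by
  refine HistoryTailLaneTailChi.historyTailL_of_pinnedPartsRecFLChi fun L hLo hL => ?_
  obtain ⟨a₀, a₁, B₃, ha₀, ha₁, hB₃, hT, -⟩ := hT8 L hLo hL
  obtain ⟨B₀, A₀, A₁, hA₀, hA₁, h⟩ := hrows L hLo hL
  exact pinnedPartsT3ACRecFLChi_of_thm1_regionalLiftsWindow_rows hL ⟨a₀, a₁, B₃, ha₀, ha₁, hB₃, hT⟩ hA₀ hA₁ h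

/-! ## §3 The plain display and the 2′ text of item 19935 with the windowed (FL) row -/

/-- ★★ **THE 2′ DISPLAY OF RECORD (item 19935, plain data rows) FROM (T) AT ANY CONSTANTS AND THE SUPPLIER ROWS, (FL) AS THE WINDOWED `hLift`**
(`RecordFLOneSupplier.pinnedPartsT3ACRecFL_of_thm1_rows` with §1). [cite: Balaban1985Variational, Thm 1 (6)–(8) pp.278–279; Balaban1985UV3, (7) p.257, (40)–(42) p.266, (68) p.273, Thm 2 p.272] -/
theorem pinnedPartsT3ACRecFL_of_thm1_regionalLiftsWindow_rows {L : ℕ} (hL : 1 < L)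
    (hT : ∃ a₀ a₁ B₃ : ℝ, 0 < a₀ ∧ 0 < a₁ ∧ 0 < B₃ ∧ Thm1GlobalMinAt L a₀ a₁ B₃)
    {B₀ A₀ A₁ : ℝ} (hA₀ : 0 < A₀) (hA₁ : 0 < A₁)
    (hrows : ∀ (B a₀ a₁ : ℝ), B₀ ≤ B → 1 ≤ 2 * B → 0 < a₀ → a₀ ≤ A₀ → 0 < a₁ → a₁ ≤ A₁ → B * a₁ ≤ a₀ →
        (143 * ((((3 + 4 : ℕ) : ℝ)) ^ 2 / 4) ^ 2) * (2 * (B * a₁)) ≤ 1 / 3 →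
        2 * (2 * (B * a₁)) ≤ 2 * deltaSU (Fin 2) / (((3 + 4) * L : ℕ) : ℝ) ^ 2 →
        Thm1GlobalMinAt L a₀ a₁ B →
        ∃ (b₁ p₁ : ℝ), ∀ (b₀ p₀ : ℝ), b₁ ≤ b₀ → p₁ ≤ p₀ →
          ∃ 𝔠 : AlphaConsts L (suGroupModel 2).N, 𝔠.b₀ = b₀ ∧ 𝔠.p₀ = p₀ ∧ 𝔠.B₃ = B ∧
            4 * 𝔠.B₃ * (L : ℝ) ^ 2 * avgWindowFactor L ≤ 𝔠.C68 ∧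
            Real.exp (𝔠.p₀ - 1) ≤ 3 * C0 3 * 𝔠.C68 * (𝔠.b₀ * Q0 𝔠.p₀) ∧
            (𝔠.b₀ * Q0 𝔠.p₀) * (2 * (L : ℝ) ^ 2 * avgWindowFactor L) ^ 2 ≤ 3 * C0 3 * 𝔠.C68 * a₁ ^ 2 ∧
            7 * L + 3 ≤ 𝔠.M₁ ∧
            ∀ (F : T3Family) (hF : F.L = L),
              (∃ B_L εFL : ℝ, 1 ≤ B_L ∧ B_L * (F.L : ℝ) ^ 2 ≤ (hF ▸ 𝔠).B₃ ∧ avgWindowFactor F.L ≤ 8 * (hF ▸ 𝔠).B₃ * (hF ▸ 𝔠).Zfull * εFL ∧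
                ∀ (γ : ℝ) (hγ : 0 < γ) (hγ1 : γ ≤ (min (hF ▸ 𝔠).gamma0 1) ^ 2) (K : ℕ),
                ∀ (k : ℕ), k + 1 ≤ K → ∀ (h : Hist (F.P K) (k + 1)),
                  Hist.Admissible (hF ▸ 𝔠).lane.carrier.M₁ (rcolOf (T3Scales F γ hγ (hγ1.trans (sq_min_one_le _ (hF ▸ 𝔠).gamma0_pos)) K) (hF ▸ 𝔠).lane.carrier) (k + 1) h →
                  h ≠ Hist.triv (F.P K) (k + 1) → ∀ (V : GaugeField (F.P K) k (Matrix.specialUnitaryGroup (Fin 2) ℂ)),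
                    (∀ Q : Plaq (F.P K) k, Q ∈ plaqsIn k (Omega (hF ▸ 𝔠).lane.carrier.M₁
                        (rcolOf (T3Scales F γ hγ (hγ1.trans (sq_min_one_le _ (hF ▸ 𝔠).gamma0_pos)) K) (hF ▸ 𝔠).lane.carrier) (k + 1) h (k + 1)) →
                      GaugeGroup.dist1 (GaugeField.plaqHol V Q) ≤ 2 * (F.L : ℝ) ^ 2 * avgWindowFactor F.L * θBal F.L γ (hF ▸ 𝔠).b₀ (hF ▸ 𝔠).p₀ (K - k)) →
                    2 * (F.L : ℝ) ^ 2 * avgWindowFactor F.L * θBal F.L γ (hF ▸ 𝔠).b₀ (hF ▸ 𝔠).p₀ (K - k) ≤ εFL →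
                    ∃ U : GaugeField (F.P K) 0 (Matrix.specialUnitaryGroup (Fin 2) ℂ),
                      (∀ b : PBond (F.P K) k, b ∈ bondsIn k (Omega (hF ▸ 𝔠).lane.carrier.M₁
                          (rcolOf (T3Scales F γ hγ (hγ1.trans (sq_min_one_le _ (hF ▸ 𝔠).gamma0_pos)) K) (hF ▸ 𝔠).lane.carrier) (k + 1) h (k + 1)) →
                        Averaging.iter (fun i => BlockAveraging.blockAvg (P := F.P K) (j := i) ℰp) k U b = V b) ∧
                      ∀ q : Plaq (F.P K) 0, q ∈ plaqsIn 0 (Omega (hF ▸ 𝔠).lane.carrier.M₁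
                          (rcolOf (T3Scales F γ hγ (hγ1.trans (sq_min_one_le _ (hF ▸ 𝔠).gamma0_pos)) K) (hF ▸ 𝔠).lane.carrier) (k + 1) h (k + 1)) →
                        GaugeGroup.dist1 (GaugeField.plaqHol U q) <
                          B_L * (2 * (F.L : ℝ) ^ 2 * avgWindowFactor F.L * θBal F.L γ (hF ▸ 𝔠).b₀ (hF ▸ 𝔠).p₀ (K - k)) * (((F.L : ℝ) ^ k)⁻¹) ^ 2) ∧
              (∀ (γ : ℝ) (hγ : 0 < γ) (hγ1 : γ ≤ (min (hF ▸ 𝔠).gamma0 1) ^ 2) (K : ℕ),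
                (∃ Ut : (k : ℕ) → GaugeField (F.P K) k (Matrix.specialUnitaryGroup (Fin 2) ℂ) →
                    GaugeField (F.P K) 0 (Matrix.specialUnitaryGroup (Fin 2) ℂ),
                  AlphaInputsT3AC.TrivMinimiserRowsT3 F (hF ▸ 𝔠) γ hγ hγ1 a₀ a₁ K Ut) →
                ∃ Ut : (k : ℕ) → GaugeField (F.P K) k (Matrix.specialUnitaryGroup (Fin 2) ℂ) →
                    GaugeField (F.P K) 0 (Matrix.specialUnitaryGroup (Fin 2) ℂ),
                  AlphaInputsT3AC.TrivMinimiserRowsT3 F (hF ▸ 𝔠) γ hγ hγ1 a₀ a₁ K Ut ∧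
                    AlphaInputsT3AC.DataRowsT3X F (hF ▸ 𝔠) γ hγ hγ1 K Ut)) :
    AlphaInputsT3AC.PinnedPartsT3ACRecFL L := by
  refine pinnedPartsT3ACRecFL_of_thm1_rows hL hT hA₀ hA₁ (B₀ := B₀) fun B a₀ a₁ h1 h2 h3 h4 h5 h6 h7 h8 h9 h10 => ?_
  obtain ⟨b₁, p₁, hrec⟩ := hrows B a₀ a₁ h1 h2 h3 h4 h5 h6 h7 h8 h9 h10
  refine ⟨b₁, p₁, fun b₀ p₀ hb hp => ?_⟩
  obtain ⟨𝔠, e1, e2, e3, s1, s2, s3, s4, hFO⟩ := hrec b₀ p₀ hb hp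
  refine ⟨𝔠, e1, e2, e3, s1, s2, s3, s4, fun F hF => ⟨fun γ hγ hγ1 K => ?_, (hFO F hF).2⟩⟩
  obtain ⟨B_L, εFL, hBL, hBB, hrow, hLift⟩ := (hFO F hF).1
  exact innerFineLiftsT3_of_regionalLiftsWindow_le hBL hBB hrow (hLift γ hγ hγ1 K)

/-- ★★ **THE REGISTERED 2′ TEXT `AlphaInputsT3ACv3Rec L` (item 19935) FROM (T) AT ANY CONSTANTS AND THE SUPPLIER ROWS, (FL) AS THE WINDOWED `hLift`** (§3's display through this
seat's g4 `alphaInputsT3ACv3Rec_of_pinnedPartsRecFL`). [cite: Balaban1985UV3, Thm 2 p.272 and (47) p.267; Balaban1985Variational, Thm 1 (8) p.279] -/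
theorem alphaInputsT3ACv3Rec_of_thm1_regionalLiftsWindow_rows {L : ℕ} (hL : 1 < L)
    (hT : ∃ a₀ a₁ B₃ : ℝ, 0 < a₀ ∧ 0 < a₁ ∧ 0 < B₃ ∧ Thm1GlobalMinAt L a₀ a₁ B₃)
    {B₀ A₀ A₁ : ℝ} (hA₀ : 0 < A₀) (hA₁ : 0 < A₁)
    (hrows : ∀ (B a₀ a₁ : ℝ), B₀ ≤ B → 1 ≤ 2 * B → 0 < a₀ → a₀ ≤ A₀ → 0 < a₁ → a₁ ≤ A₁ → B * a₁ ≤ a₀ →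
        (143 * ((((3 + 4 : ℕ) : ℝ)) ^ 2 / 4) ^ 2) * (2 * (B * a₁)) ≤ 1 / 3 →
        2 * (2 * (B * a₁)) ≤ 2 * deltaSU (Fin 2) / (((3 + 4) * L : ℕ) : ℝ) ^ 2 →
        Thm1GlobalMinAt L a₀ a₁ B →
        ∃ (b₁ p₁ : ℝ), ∀ (b₀ p₀ : ℝ), b₁ ≤ b₀ → p₁ ≤ p₀ →
          ∃ 𝔠 : AlphaConsts L (suGroupModel 2).N, 𝔠.b₀ = b₀ ∧ 𝔠.p₀ = p₀ ∧ 𝔠.B₃ = B ∧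
            4 * 𝔠.B₃ * (L : ℝ) ^ 2 * avgWindowFactor L ≤ 𝔠.C68 ∧
            Real.exp (𝔠.p₀ - 1) ≤ 3 * C0 3 * 𝔠.C68 * (𝔠.b₀ * Q0 𝔠.p₀) ∧
            (𝔠.b₀ * Q0 𝔠.p₀) * (2 * (L : ℝ) ^ 2 * avgWindowFactor L) ^ 2 ≤ 3 * C0 3 * 𝔠.C68 * a₁ ^ 2 ∧
            7 * L + 3 ≤ 𝔠.M₁ ∧
            ∀ (F : T3Family) (hF : F.L = L),
              (∃ B_L εFL : ℝ, 1 ≤ B_L ∧ B_L * (F.L : ℝ) ^ 2 ≤ (hF ▸ 𝔠).B₃ ∧ avgWindowFactor F.L ≤ 8 * (hF ▸ 𝔠).B₃ * (hF ▸ 𝔠).Zfull * εFL ∧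
                ∀ (γ : ℝ) (hγ : 0 < γ) (hγ1 : γ ≤ (min (hF ▸ 𝔠).gamma0 1) ^ 2) (K : ℕ),
                ∀ (k : ℕ), k + 1 ≤ K → ∀ (h : Hist (F.P K) (k + 1)),
                  Hist.Admissible (hF ▸ 𝔠).lane.carrier.M₁ (rcolOf (T3Scales F γ hγ (hγ1.trans (sq_min_one_le _ (hF ▸ 𝔠).gamma0_pos)) K) (hF ▸ 𝔠).lane.carrier) (k + 1) h →
                  h ≠ Hist.triv (F.P K) (k + 1) → ∀ (V : GaugeField (F.P K) k (Matrix.specialUnitaryGroup (Fin 2) ℂ)),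
                    (∀ Q : Plaq (F.P K) k, Q ∈ plaqsIn k (Omega (hF ▸ 𝔠).lane.carrier.M₁
                        (rcolOf (T3Scales F γ hγ (hγ1.trans (sq_min_one_le _ (hF ▸ 𝔠).gamma0_pos)) K) (hF ▸ 𝔠).lane.carrier) (k + 1) h (k + 1)) →
                      GaugeGroup.dist1 (GaugeField.plaqHol V Q) ≤ 2 * (F.L : ℝ) ^ 2 * avgWindowFactor F.L * θBal F.L γ (hF ▸ 𝔠).b₀ (hF ▸ 𝔠).p₀ (K - k)) →
                    2 * (F.L : ℝ) ^ 2 * avgWindowFactor F.L * θBal F.L γ (hF ▸ 𝔠).b₀ (hF ▸ 𝔠).p₀ (K - k) ≤ εFL →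
                    ∃ U : GaugeField (F.P K) 0 (Matrix.specialUnitaryGroup (Fin 2) ℂ),
                      (∀ b : PBond (F.P K) k, b ∈ bondsIn k (Omega (hF ▸ 𝔠).lane.carrier.M₁
                          (rcolOf (T3Scales F γ hγ (hγ1.trans (sq_min_one_le _ (hF ▸ 𝔠).gamma0_pos)) K) (hF ▸ 𝔠).lane.carrier) (k + 1) h (k + 1)) →
                        Averaging.iter (fun i => BlockAveraging.blockAvg (P := F.P K) (j := i) ℰp) k U b = V b) ∧
                      ∀ q : Plaq (F.P K) 0, q ∈ plaqsIn 0 (Omega (hF ▸ 𝔠).lane.carrier.M₁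
                          (rcolOf (T3Scales F γ hγ (hγ1.trans (sq_min_one_le _ (hF ▸ 𝔠).gamma0_pos)) K) (hF ▸ 𝔠).lane.carrier) (k + 1) h (k + 1)) →
                        GaugeGroup.dist1 (GaugeField.plaqHol U q) <
                          B_L * (2 * (F.L : ℝ) ^ 2 * avgWindowFactor F.L * θBal F.L γ (hF ▸ 𝔠).b₀ (hF ▸ 𝔠).p₀ (K - k)) * (((F.L : ℝ) ^ k)⁻¹) ^ 2) ∧
              (∀ (γ : ℝ) (hγ : 0 < γ) (hγ1 : γ ≤ (min (hF ▸ 𝔠).gamma0 1) ^ 2) (K : ℕ),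
                (∃ Ut : (k : ℕ) → GaugeField (F.P K) k (Matrix.specialUnitaryGroup (Fin 2) ℂ) →
                    GaugeField (F.P K) 0 (Matrix.specialUnitaryGroup (Fin 2) ℂ),
                  AlphaInputsT3AC.TrivMinimiserRowsT3 F (hF ▸ 𝔠) γ hγ hγ1 a₀ a₁ K Ut) →
                ∃ Ut : (k : ℕ) → GaugeField (F.P K) k (Matrix.specialUnitaryGroup (Fin 2) ℂ) →
                    GaugeField (F.P K) 0 (Matrix.specialUnitaryGroup (Fin 2) ℂ),
                  AlphaInputsT3AC.TrivMinimiserRowsT3 F (hF ▸ 𝔠) γ hγ hγ1 a₀ a₁ K Ut ∧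
                    AlphaInputsT3AC.DataRowsT3X F (hF ▸ 𝔠) γ hγ hγ1 K Ut)) :
    AlphaInputsT3ACv3Rec L :=
  alphaInputsT3ACv3Rec_of_pinnedPartsRecFL (pinnedPartsT3ACRecFL_of_thm1_regionalLiftsWindow_rows hL hT hA₀ hA₁ hrows)

end Summit.QuantumFields.YangMills.Theorems.HistoryTailOneSupplier

end
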